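import Summits.AtomisticToContinuum.HydrodynamicLimit.Cruxes.EquilibriumFastWindowLD.IdeatorK1Sketch
import Summits.AtomisticToContinuum.HydrodynamicLimit.Theorems.TwoClocksEquilibriumFastWindowLDWindowExtension
import Summits.AtomisticToContinuum.HydrodynamicLimit.Theorems.TwoClocksEquilibriumFastWindowLDStubOneSiteGauss
import Summits.AtomisticToContinuum.HydrodynamicLimit.Theorems.TwoClocksEquilibriumShearWindowLDCentring
import Summits.AtomisticToContinuum.HydrodynamicLimit.Theorems.TwoClocksEquilibriumShearWindowLDWindows
import Summits.AtomisticToContinuum.HydrodynamicLimit.Theorems.JParityClosureEvenStressEnskogVelocityFactorisation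

/-!
# Crux-triage evidence (stmt-AtomisticToContinuum-14440, round 1, triager 2): the transfer target of
# the idea `holder-defect-doubling` is implied by the crux

`TwoWindowHolderDefect` (the card's C⁺, typed in `Cruxes/EquilibriumFastWindowLD/IdeatorK1Sketch.lean`,
quantifier order `∃ α ∃ β₀ ∀ b ∀ ε ∀ δ ∃ τ₀ ∀ τ ≥ τ₀ ∃ N₀ ∀ N ≥ N₀`) follows from the crux
`TwoClocks.EquilibriumFastWindowLD` for EVERY exponent `α ∈ [1, 2)` (here `α = 1`), by:

* Cauchy–Schwarz: `∫ e^{b(Ā₁+Ā₂)} dG ≤ (∫ e^{2bĀ₁} dG)^{1/2} (∫ e^{2bĀ₂} dG)^{1/2}`;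
* the group property on the good set (`HardSphereFlow.flow_add`): `Ā₂ = Ā₁ ∘ Φ_{(1+δ)w}`, and
  invariance of the homogeneous Gibbs law (`measurePreserving_flow_localGibbsLaw_const`):
  `∫ e^{2bĀ₂} dG = ∫ e^{2bĀ₁} dG`;
* the crux at tilt `2b` with tolerance `ε b²` (`b ≠ 0`; `b = 0` is trivial), its `∃ τ` upgraded to
  `∀ τ' ≥ τ₀` by `windowMoment_eventually_of_exists` + `stub_oneSiteGauss` (both landed, line `Sketch`);
* Jensen: `1 ≤ ∫ e^{αbĀ₁} dG` (`one_le_lintegral_exp_windowSum`; the one-body mean of `F` vanishes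
  under `G_N` by Maxwellian-orthogonality to `1`, Fubini `integral_localGibbsLaw_const_eq_integral_integral`).

Consequence for the triage: together with the card's own `HalvingReduction : TwoWindowHolderDefect →
WindowPressureStaticBound → EquilibriumFastWindowLD` (correct real analysis), C⁺ ⟺ crux — the line's
only dynamical stub is crux-equivalent, the failure mode recorded for the dead line `Sketch`
(`Lines/SketchDead.md`).

refuter-cruxtri-stmt-AtomisticToContinuum-14440-r1-2-0, 2026-08-17.
-/

noncomputable section

open MeasureTheory ProbabilityTheory Real Set Filter
open scoped ENNReal BigOperators

namespace Summit.AtomisticToContinuum.HydrodynamicLimit.Cruxes.EquilibriumFastWindowLD.Triage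

open Literature.Analysis.FluidPDE Literature.MathematicalPhysics.KineticTheory
open Summit.AtomisticToContinuum.HydrodynamicLimit.Theorems
open Summit.AtomisticToContinuum.HydrodynamicLimit.Theorems.FastWindowRG
open Summit.AtomisticToContinuum.HydrodynamicLimit.Theorems.EvenStressEnskog
open Summit.AtomisticToContinuum.HydrodynamicLimit.Cruxes.EquilibriumFastWindowLD.Ideas

/-! ## One-body centring under the homogeneous Gibbs law -/

/-- Integration against `gaussMeasure u θ` is integration against the Maxwellian density
`M_{1,u,θ}` (`withDensity_localMaxwellian_eq_gaussMeasure`). [folklore] -/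
theorem integral_gaussMeasure_eq_integral_mul_localMaxwellian {θ : ℝ} (hθ : 0 < θ)
    (u : V3) (g : V3 → ℝ) :
    ∫ v, g v ∂(gaussMeasure u θ) = ∫ v, g v * localMaxwellian 1 θ u v := by
  rw [← withDensity_localMaxwellian_eq_gaussMeasure hθ u,
    integral_withDensity_eq_integral_toReal_smul₀
      (continuous_localMaxwellian 1 θ u).measurable.ennreal_ofReal.aemeasurable
      (Eventually.of_forall fun _ => ENNReal.ofReal_lt_top)]
  refine integral_congr_ae (Eventually.of_forall fun v => ?_)
  simp only
  rw [ENNReal.toReal_ofReal (localMaxwellian_nonneg zero_le_one hθ.le u v), smul_eq_mul, mul_comm]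

/-- A quadratic-growth constant is nonnegative. [folklore] -/
theorem nonneg_of_growth_bound {F : T3 × V3 → ℝ} {C : ℝ}
    (hC : ∀ y, |F y| ≤ C * (1 + ‖y.2‖ ^ 2)) : 0 ≤ C := by
  set y := Classical.arbitrary (T3 × V3)
  have h0 := hC y
  have hp : (0 : ℝ) < 1 + ‖y.2‖ ^ 2 := by positivity
  nlinarith [abs_nonneg (F y)]

/-- One-body observables of quadratic growth are integrable under the homogeneous Gibbs law
(energy is integrable, `integrable_configEnergy_localGibbsLaw_const`). [folklore] -/
theorem integrable_oneBody {a θ : ℝ} (ha : 0 < a) (hθ : 0 < θ) (u : V3) {σ : ℝ} (hσ2 : σ ≤ 1 / 2)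
    (N : ℕ) (Φ : HardSphereFlow (Torus.geometry (Fin 3)) (hsDiameter σ N) (N + 1))
    {F : T3 × V3 → ℝ} (hF : Continuous F) {C : ℝ} (hC : ∀ y, |F y| ≤ C * (1 + ‖y.2‖ ^ 2))
    (i : Fin (N + 1)) :
    Integrable (fun z : Config (N + 1) (Fin 3) T3 => F (z i))
      (localGibbsLaw σ (fun _ => a) (fun _ => u) (fun _ => θ) N Φ) := by
  have hC0 : 0 ≤ C := nonneg_of_growth_bound hC
  haveI : IsProbabilityMeasure (localGibbsLaw σ (fun _ => a) (fun _ => u) (fun _ => θ) N Φ) :=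
    isProbabilityMeasure_localGibbsLaw (a₀ := fun _ => a) (θ₀ := fun _ => θ) (u₀ := fun _ => u)
      continuous_const continuous_const continuous_const (fun _ => ha) (fun _ => hθ) hσ2 N Φ
  have hEi := integrable_configEnergy_localGibbsLaw_const ha hθ u hσ2 N Φ
  have hg : Integrable (fun z : Config (N + 1) (Fin 3) T3 => C * (1 + 2 * configEnergy z))
      (localGibbsLaw σ (fun _ => a) (fun _ => u) (fun _ => θ) N Φ) :=
    ((integrable_const (1 : ℝ)).add (hEi.const_mul 2)).const_mul C
  refine hg.mono' (hF.measurable.comp (measurable_pi_apply i)).aestronglyMeasurable ?_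
  refine Eventually.of_forall fun z => ?_
  rw [Real.norm_eq_abs]
  calc |F (z i)| ≤ C * (1 + ‖(z i).2‖ ^ 2) := hC (z i)
    _ ≤ C * (1 + 2 * configEnergy z) := by
        gcongr
        exact norm_vel_sq_le_two_mul_configEnergy z i

/-- **Maxwellian-orthogonality to `1` at every `x` centres the one-body observable under the
homogeneous Gibbs law**: `∫ F(z i) dG_N = 0` (Fubini over positions × i.i.d. Maxwellian velocities).
[folklore] -/
theorem integral_oneBody_eq_zero {a θ : ℝ} (ha : 0 < a) (hθ : 0 < θ) (u : V3) {σ : ℝ}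
    (hσ2 : σ ≤ 1 / 2) (N : ℕ) (Φ : HardSphereFlow (Torus.geometry (Fin 3)) (hsDiameter σ N) (N + 1))
    {F : T3 × V3 → ℝ} (hF : Continuous F) {C : ℝ} (hC : ∀ y, |F y| ≤ C * (1 + ‖y.2‖ ^ 2))
    (hF0 : ∀ x, ∫ v, F (x, v) * localMaxwellian 1 θ u v = 0) (i : Fin (N + 1)) :
    ∫ z, F (z i) ∂(localGibbsLaw σ (fun _ => a) (fun _ => u) (fun _ => θ) N Φ) = 0 := by
  rw [integral_localGibbsLaw_const_eq_integral_integral σ ha.le hθ u N Φ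
    (integrable_oneBody ha hθ u hσ2 N Φ hF hC i)]
  simp only [zipConfig_apply]
  have hinner : ∀ x : Fin (N + 1) → T3,
      ∫ v, F (x i, v i) ∂(Measure.pi fun _ : Fin (N + 1) => gaussMeasure u θ) = 0 := by
    intro x
    have hψ := measurePreserving_eval (fun _ : Fin (N + 1) => gaussMeasure u θ) i
    have hgm : AEStronglyMeasurable (fun w : V3 => F (x i, w))
        (Measure.map (Function.eval i) (Measure.pi fun _ : Fin (N + 1) => gaussMeasure u θ)) := by
      rw [hψ.map_eq]
      exact (hF.comp (Continuous.prodMk_right (x i))).aestronglyMeasurable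
    have h := integral_map hψ.measurable.aemeasurable hgm
    rw [hψ.map_eq] at h
    simp only [Function.eval] at h
    rw [← h, integral_gaussMeasure_eq_integral_mul_localMaxwellian hθ u, hF0]
  simp [hinner]

/-! ## Small `ENNReal` helpers -/

/-- `ofReal (exp (b y)) ^ 2 = ofReal (exp (2 b y))`. [folklore] -/
theorem ofReal_exp_rpow_two (b y : ℝ) :
    ENNReal.ofReal (Real.exp (b * y)) ^ (2 : ℝ) = ENNReal.ofReal (Real.exp (2 * b * y)) := by
  rw [ENNReal.ofReal_rpow_of_pos (Real.exp_pos _), ← Real.exp_mul]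
  congr 2
  ring

/-! ## The implication -/

/-- **The crux implies the two-window Hölder defect (with `α = 1`).** See the module docstring.
[folklore] -/
theorem twoWindowHolderDefect_of_equilibriumFastWindowLD
    (h : Summit.AtomisticToContinuum.HydrodynamicLimit.Theses.TwoClocks.EquilibriumFastWindowLD) :
    TwoWindowHolderDefect := by
  obtain ⟨σ₀, hσ₀, H⟩ := h
  refine ⟨min σ₀ (1 / 2), lt_min hσ₀ (by norm_num), ?_⟩
  intro a₀ θ₀ u₀ ha hθ σ hσ hσlt Φ F hFast
  have hσ₀' : σ < σ₀ := hσlt.trans_le (min_le_left _ _)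
  have hσ2 : σ ≤ 1 / 2 := (hσlt.trans_le (min_le_right _ _)).le
  obtain ⟨hF, ⟨C, hC⟩, hF1, hFv, hFE⟩ := hFast
  -- the crux for `F`
  obtain ⟨β₀, hβ₀, Hβ⟩ := H a₀ θ₀ u₀ ha hθ σ hσ hσ₀' Φ F hF ⟨C, hC⟩ hF1 hFv hFE
  -- the static one-site Gaussian bound (needed only to make the crux's `∃ τ` eventual in `τ`)
  have hC0 : 0 ≤ C := nonneg_of_growth_bound hC
  obtain ⟨t₀, ht₀, K, hK, hone⟩ := stub_oneSiteGauss hθ u₀ hC0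
  -- exponent `α = 1`, tilt range `min (β₀/2) (t₀/2)`
  refine ⟨1, le_rfl, by norm_num, min (β₀ / 2) (t₀ / 2), lt_min (half_pos hβ₀) (half_pos ht₀), ?_⟩
  intro b hb ε hε δ hδ
  have hb₁ : |b| ≤ β₀ / 2 := hb.trans (min_le_left _ _)
  have hb₂ : |b| ≤ t₀ / 2 := hb.trans (min_le_right _ _)
  have h2b : |2 * b| ≤ β₀ := by rw [abs_mul, abs_two]; linarith
  have h2bt : |2 * b| ≤ t₀ := by rw [abs_mul, abs_two]; linarith
  -- Step A: the crux at tilt `2b`, eventual in the window: `M_N(2b, τ) ≤ exp(ε b² (N+1))`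
  have hA : ∃ τ₀ : ℝ, 0 < τ₀ ∧ ∀ τ : ℝ, τ₀ ≤ τ → ∃ N₀ : ℕ, ∀ N : ℕ, N₀ ≤ N →
      ∫⁻ z, ENNReal.ofReal (Real.exp ((2 * b) * ∑ i : Fin (N + 1),
        (τ * ((N : ℝ) + 1) ^ (-(1 / 3 : ℝ)))⁻¹ *
          ∫ r in (0 : ℝ)..(τ * ((N : ℝ) + 1) ^ (-(1 / 3 : ℝ))), F (((Φ N).flow r z) i)))
        ∂(localGibbsLaw σ (fun _ => a₀) (fun _ => u₀) (fun _ => θ₀) N (Φ N)) ≤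
      ENNReal.ofReal (Real.exp (ε * b ^ 2 * ((N : ℝ) + 1))) := by
    rcases eq_or_ne b 0 with rfl | hb0
    · refine ⟨1, one_pos, fun τ _ => ⟨0, fun N _ => ?_⟩⟩
      haveI : IsProbabilityMeasure
          (localGibbsLaw σ (fun _ => a₀) (fun _ => u₀) (fun _ => θ₀) N (Φ N)) :=
        isProbabilityMeasure_localGibbsLaw (a₀ := fun _ => a₀) (θ₀ := fun _ => θ₀)
          (u₀ := fun _ => u₀) continuous_const continuous_const continuous_const
          (fun _ => ha) (fun _ => hθ) hσ2 N (Φ N)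
      simp
    · have hεb : 0 < ε * b ^ 2 := mul_pos hε (by positivity)
      obtain ⟨τ, hτ, N₀, hN⟩ := Hβ (2 * b) h2b (ε * b ^ 2 / 2) (half_pos hεb)
      have hone' : ∀ x : T3, ∫⁻ v, ENNReal.ofReal (Real.exp ((2 * b) * F (x, v)))
          ∂(gaussMeasure u₀ θ₀) ≤ ENNReal.ofReal (Real.exp (K * (2 * b) ^ 2)) := fun x =>
        hone (fun v => F (x, v)) (hF.comp (Continuous.prodMk_right x)).measurable
          (fun v => hC (x, v)) (hF1 x) (2 * b) h2bt
      have hev := windowMoment_eventually_of_exists ha hθ u₀ hσ2 Φ hF hK hone' hεb hτ hN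
      exact ⟨τ * (1 + 2 * K * (2 * b) ^ 2 / (ε * b ^ 2)), by positivity,
        fun τ' hτ' => ⟨N₀, fun N hNN => hev τ' hτ' N hNN⟩⟩
  obtain ⟨τ₀, hτ₀, hA⟩ := hA
  refine ⟨τ₀, hτ₀, fun τ hτ => ?_⟩
  obtain ⟨N₀, hN⟩ := hA τ hτ
  refine ⟨N₀, fun N hNN => ?_⟩
  have hτpos : 0 < τ := hτ₀.trans_le hτ
  -- unfold the `let`s and the Sketch's abbreviations
  simp only [windowAvg, window, gibbs, zero_add, one_mul, div_one]
  set w : ℝ := τ * ((N : ℝ) + 1) ^ (-(1 / 3 : ℝ)) with hw_def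
  set G : Measure (Config (N + 1) (Fin 3) T3) :=
    localGibbsLaw σ (fun _ => a₀) (fun _ => u₀) (fun _ => θ₀) N (Φ N) with hG_def
  have hw : 0 < w := mul_pos hτpos (Real.rpow_pos_of_pos (by positivity) _)
  haveI : IsProbabilityMeasure G :=
    isProbabilityMeasure_localGibbsLaw (a₀ := fun _ => a₀) (θ₀ := fun _ => θ₀)
      (u₀ := fun _ => u₀) continuous_const continuous_const continuous_const
      (fun _ => ha) (fun _ => hθ) hσ2 N (Φ N)
  have hgood : G (Φ N).goodᶜ = 0 := localGibbsLaw_const_compl_good σ a₀ θ₀ u₀ N (Φ N)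
  have hinv : ∀ t, MeasurePreserving ((Φ N).flow t) G G :=
    measurePreserving_flow_localGibbsLaw_const σ a₀ θ₀ u₀ N (Φ N)
  -- the two window functionals
  set A₁ : Config (N + 1) (Fin 3) T3 → ℝ :=
    fun z => ∑ i, w⁻¹ * ∫ r in (0 : ℝ)..w, F ((Φ N).flow r z i) with hA₁
  set A₂ : Config (N + 1) (Fin 3) T3 → ℝ :=
    fun z => ∑ i, w⁻¹ * ∫ r in ((1 + δ) * w)..((1 + δ) * w + w), F ((Φ N).flow r z i) with hA₂
  -- the bound at tilt `2b` (Step A at this `τ, N`)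
  have h2 : ∫⁻ z, ENNReal.ofReal (Real.exp ((2 * b) * A₁ z)) ∂G ≤
      ENNReal.ofReal (Real.exp (ε * b ^ 2 * ((N : ℝ) + 1))) := hN N hNN
  -- (i) shift identity on the good set
  have hshiftpt : ∀ z ∈ (Φ N).good, A₂ z = A₁ ((Φ N).flow ((1 + δ) * w) z) := by
    intro z hz
    simp only [hA₁, hA₂]
    refine Finset.sum_congr rfl fun i _ => ?_
    congr 1
    have hfl : ∀ r, (Φ N).flow r ((Φ N).flow ((1 + δ) * w) z) = (Φ N).flow (r + (1 + δ) * w) z :=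
      fun r => ((Φ N).flow_add r ((1 + δ) * w) z hz).symm
    simp_rw [hfl]
    rw [intervalIntegral.integral_comp_add_right (fun r => F ((Φ N).flow r z i)) ((1 + δ) * w),
      zero_add, add_comm w]
  -- (ii) measurability
  have hA₁m : AEMeasurable A₁ G := by
    refine Finset.aemeasurable_fun_sum _ fun i _ => ?_
    exact ((Φ N).aemeasurable_intervalIntegral_comp_flow_torus
      (hF.measurable.comp (measurable_pi_apply i)) 0 w hgood).const_mul _
  have hA₂m : AEMeasurable A₂ G := by
    refine Finset.aemeasurable_fun_sum _ fun i _ => ?_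
    exact ((Φ N).aemeasurable_intervalIntegral_comp_flow_torus
      (hF.measurable.comp (measurable_pi_apply i)) _ _ hgood).const_mul _
  have hf : AEMeasurable (fun z => ENNReal.ofReal (Real.exp (b * A₁ z))) G :=
    (Real.measurable_exp.comp_aemeasurable (hA₁m.const_mul b)).ennreal_ofReal
  have hg : AEMeasurable (fun z => ENNReal.ofReal (Real.exp (b * A₂ z))) G :=
    (Real.measurable_exp.comp_aemeasurable (hA₂m.const_mul b)).ennreal_ofReal
  -- (iii) invariance: the second window has the same `2b`-moment as the first
  have hshift : ∫⁻ z, ENNReal.ofReal (Real.exp ((2 * b) * A₂ z)) ∂G =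
      ∫⁻ z, ENNReal.ofReal (Real.exp ((2 * b) * A₁ z)) ∂G := by
    have hgoodae : ∀ᵐ z ∂G, z ∈ (Φ N).good :=
      (measure_eq_zero_iff_ae_notMem.1 hgood).mono fun z hz => by simpa using hz
    have hae : ∀ᵐ z ∂G, ENNReal.ofReal (Real.exp ((2 * b) * A₂ z)) =
        ENNReal.ofReal (Real.exp ((2 * b) * A₁ ((Φ N).flow ((1 + δ) * w) z))) := by
      filter_upwards [hgoodae] with z hz
      rw [hshiftpt z hz]
    rw [lintegral_congr_ae hae]
    have hm : AEMeasurable (fun z => ENNReal.ofReal (Real.exp ((2 * b) * A₁ z)))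
        (G.map ((Φ N).flow ((1 + δ) * w))) := by
      rw [(hinv _).map_eq]
      exact (Real.measurable_exp.comp_aemeasurable (hA₁m.const_mul (2 * b))).ennreal_ofReal
    rw [← lintegral_map' hm ((Φ N).measurable_flow _).aemeasurable, (hinv _).map_eq]
  -- (iv) Cauchy–Schwarz
  have hCS : ∫⁻ z, ENNReal.ofReal (Real.exp (b * (A₁ z + A₂ z))) ∂G ≤
      ∫⁻ z, ENNReal.ofReal (Real.exp ((2 * b) * A₁ z)) ∂G := by
    have hsplit : ∀ z, ENNReal.ofReal (Real.exp (b * (A₁ z + A₂ z))) =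
        ENNReal.ofReal (Real.exp (b * A₁ z)) * ENNReal.ofReal (Real.exp (b * A₂ z)) := by
      intro z
      rw [mul_add, Real.exp_add, ENNReal.ofReal_mul (Real.exp_nonneg _)]
    simp_rw [hsplit]
    have hH := ENNReal.lintegral_mul_le_Lp_mul_Lq G Real.HolderConjugate.two_two hf hg
    simp only [Pi.mul_apply, ofReal_exp_rpow_two] at hH
    rw [hshift, ← ENNReal.rpow_add_of_nonneg _ _ (by norm_num) (by norm_num),
      show (1 / 2 : ℝ) + 1 / 2 = 1 by norm_num, ENNReal.rpow_one] at hH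
    exact hH
  -- (v) Jensen: the `α = 1` moment is at least `1`
  have hJ : 1 ≤ (∫⁻ z, ENNReal.ofReal (Real.exp (b * A₁ z)) ∂G) ^ (2 : ℝ) := by
    refine ENNReal.one_le_rpow ?_ two_pos
    exact one_le_lintegral_exp_windowSum ha hθ u₀ hσ2 N (Φ N) hF ⟨C, hC⟩
      (fun i => integral_oneBody_eq_zero ha hθ u₀ hσ2 N (Φ N) hF hC hF1 i) b hw
  -- assemble
  calc ∫⁻ z, ENNReal.ofReal (Real.exp (b * (A₁ z + A₂ z))) ∂G
      ≤ ∫⁻ z, ENNReal.ofReal (Real.exp ((2 * b) * A₁ z)) ∂G := hCS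
    _ ≤ ENNReal.ofReal (Real.exp (ε * b ^ 2 * ((N : ℝ) + 1))) := h2
    _ = ENNReal.ofReal (Real.exp (ε * b ^ 2 * ((N : ℝ) + 1))) * 1 := (mul_one _).symm
    _ ≤ ENNReal.ofReal (Real.exp (ε * b ^ 2 * ((N : ℝ) + 1))) *
          (∫⁻ z, ENNReal.ofReal (Real.exp (b * A₁ z)) ∂G) ^ (2 : ℝ) := by
        gcongr

end Summit.AtomisticToContinuum.HydrodynamicLimit.Cruxes.EquilibriumFastWindowLD.Triage

end
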